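import Literature.MathematicalPhysics.QuantumFieldTheory.Balaban1983to89.B9SectBL2GStepAtLettersV3

/-!
# `Balaban1983to89.B9SectBStepFrameV6` — THE LETTERS-LEVEL SECT.-B STEP FRAME, VERSION 6: `SectBFrame₆` + ★★ `sectBStepPrinted_of_sectBFrame₆`;
# = `SectBFrame₅` (p533359) with the `L²` dictionary of G(U′U) taken as `L2GFrame₃` — NO displayed printed inequality inside the `L²` frames any
# more ((3.77) is `B9SectBL2GStepAtLettersV3.read377_of_l2GFrame₃`); displayed remain ONLY the three Hölder ∕ sup steps (3.43)–(3.45) of G(U′U)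

T. Bałaban, *Propagators for lattice gauge theories in a background field*, Commun. Math. Phys. **99** (1985) 389–434
[`Balaban1985BackgroundPropagators`, "B9"], Sect. B pp. 400–407 (Theorem 3.4); [4] = T. Bałaban, *Propagators and renormalization transformations
for lattice gauge theories. II*, Commun. Math. Phys. **96** (1984) 223–250 [`Balaban1984PropagatorsII`].

statement-level skeleton of published theorems with citation tags; proofs where landed; nothing here is a claim about the Yang–Mills mass gap

WHY (pub-ymgap N06 row 13, seat dag-n06-c g6).  `SectBFrame₅` framed all twelve `L²` member-steps of Sect. B with ONE printed inequality displayed inside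
`L2GFrame₂` ((3.77) in block-ℓ² for the concrete `P₁(A)`).  `B9SectBL2GStepAtLettersV3` proves it on the letters of `L2GFrame₃` (structured block-ℓ²
Hom-readings of `Q′, Q′*, F′, F′*` through the lattice of blocks instead).  `SectBFrame₆` swaps `L2GFrame₃` in; `SectBFrame₆.toSectBFrame₅` shows v6 ⇒ v5;
`sectBStepPrinted_of_sectBFrame₆` is the v5 capstone on it.

WHAT IS IN THE FILE (0 sorry; standard axioms): `structure SectBFrame₆ … extends GlobGFrame₂, AnGFrame₂, GlobFrame₂, H1Frame₂, E4H2Frame₂, AnFrame₂, L2GFrame₃`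
(+ `readL2_3 … writeL2_5` as v4∕v5; `readL2_2`∕`writeL2_2` sit in `L2GFrame₃`; displayed `stepH1G stepE4G stepH2G` ONLY); `SectBFrame₆.toSectBFrame₅`; ★★ `sectBStepPrinted_of_sectBFrame₆`.

HONEST SCOPE.  Hypothesis structure; NOT shown inhabited; the three displayed Hölder ∕ sup steps of G(U′U) are print's statement (Theorem 3.3 × Theorem 3.4,
p. 407), not proofs; count-neutral; NOT a node discharge; nothing continuum ∕ OS ∕ mass-gap ∕ Clay.  Cell `pub-ymgap` (HUMAN RULING D-0062), Track A node
N06 [B9], N06-ASSIGNMENT row 13, seat `pub-ymgap-dag-n06-c` (g6), 2026-08-27.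
-/

noncomputable section

namespace Literature.MathematicalPhysics.QuantumFieldTheory.Balaban1983to89.B9SectBStepFrameV6

open Literature.MathematicalPhysics.QuantumFieldTheory.Balaban1983to89
open Literature.MathematicalPhysics.QuantumFieldTheory.Balaban1983to89.B6RandomWalkL2 (HasL2Majorant)
open Literature.MathematicalPhysics.QuantumFieldTheory.Balaban1983to89.B9Thm34Ext (toB6)
open Literature.MathematicalPhysics.QuantumFieldTheory.Balaban1983to89.B9Eq352DivFormLetters (conj)
open Literature.MathematicalPhysics.QuantumFieldTheory.Balaban1983to89.B9Eq352GradLetters (diffLetter)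
open Literature.MathematicalPhysics.QuantumFieldTheory.Balaban1983to89.B9FromB6 (L2Block)
open Literature.MathematicalPhysics.QuantumFieldTheory.Balaban1983to89.B9SectBStepWhole (StepH1Pos StepE4Pos StepH2Pos)
open Literature.MathematicalPhysics.QuantumFieldTheory.Balaban1983to89.B9SectBGpStepAtLettersV2 (GpFrame₂ GlobFrame₂ H1Frame₂ E4H2Frame₂ AnFrame₂)
open Literature.MathematicalPhysics.QuantumFieldTheory.Balaban1983to89.B9SectBGStepAtLettersV2 (GFrame₂ GlobGFrame₂ AnGFrame₂)
open Literature.MathematicalPhysics.QuantumFieldTheory.Balaban1983to89.B9SectBStepFrameV5 (SectBFrame₅ sectBStepPrinted_of_sectBFrame₅)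
open Literature.MathematicalPhysics.QuantumFieldTheory.Balaban1983to89.B9SectBL2GStepAtLettersV3 (L2GFrame₃ read377_of_l2GFrame₃)

universe u

variable {I : Type} (c35 : ℝ) (geo : I → B9.Geometry) (bg : I → B9.Backgrounds)
  (Gp : ∀ i, B9.KernelFamily (geo i) (bg i))
  {𝔸 : Type u} [NormedRing 𝔸] [NormedAlgebra ℂ 𝔸] [CompleteSpace 𝔸] {ι : Type} [Fintype ι] [DecidableEq ι]
  (b : Module.Basis ι ℝ 𝔸) (κ : Type) [Fintype κ] [LinearOrder κ]
  (S : I → Type) [∀ i, Fintype (S i)] [∀ i, DecidableEq (S i)]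
  [∀ i, Fintype (geo i).Site] [∀ i, DecidableEq (geo i).Site] [∀ i, Nonempty (geo i).Site]

/-- **THE WHOLE SECT.-B LETTERS DICTIONARY, V6** — `SectBFrame₅` with the `L²` dictionary of G(U′U) taken as `L2GFrame₃` (structured block-ℓ² Hom-readings
of `Q′, Q′*, F′, F′*` through 𝔅 in place of the displayed (3.77)); displayed remain ONLY the three Hölder ∕ sup block-steps (3.43) ∕ (3.44) ∕ (3.45) of
G(U′U).  A hypothesis structure; nothing asserted.
[cite: Balaban1985BackgroundPropagators, Thm 3.4 p.400 + Sect. B pp.400–407 + Thm 3.1 (3.43)–(3.46) p.398 + Thm 3.3 p.399 + p.403 l.1–9 + p.407] -/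
structure SectBFrame₆ (GA : ∀ i, B9.KernelFamily (geo i) (bg i)) (Cinv : ∀ i, B9.SiteKernel (geo i) (bg i))
    (IsAnalyticExt : ∀ i, B9.KernelFamily (geo i) (bg i) → (bg i).Cfg → ℝ → Prop)
    extends GlobGFrame₂ c35 geo bg Gp b κ S GA Cinv, AnGFrame₂ c35 geo bg Gp b κ S GA Cinv IsAnalyticExt,
      GlobFrame₂ c35 geo bg Gp b κ S, H1Frame₂ c35 geo bg Gp b κ S, E4H2Frame₂ c35 geo bg Gp b κ S,
      AnFrame₂ c35 geo bg Gp b κ S IsAnalyticExt, L2GFrame₃ c35 geo bg Gp b κ S GA Cinv where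
  /-- READING (3.46)₃ at U per PAIR of concrete difference letters: `∇_k∇_lG′(U) ≺₂ cL·B₀·1·e^{−δd}`. -/
  readL2_3 : ∀ i (α₀ : ℝ) (U : (bg i).Cfg) (B₀ δ : ℝ), MInv ≤ (geo i).M → 0 < α₀ → (geo i).M * α₀ ≤ aInv →
    (bg i).Reg335 c35 α₀ U → 0 < B₀ → 0 < δ → L2Block (Gp i) B₀ δ U →
    ∀ k l : κ ⊕ κ, HasL2Majorant (g := toB6 (geo i) (Rr i) (Hp i)) (fun p : S i × ι => blk i p.1)
      (conj b (diffLetter (T i) (coord i U) ((((geo i).eta : ℂ))⁻¹) k) *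
        conj b (diffLetter (T i) (coord i U) ((((geo i).eta : ℂ))⁻¹) l) * Gop i U)
      (fun a a' => cL * B₀ * 1 * Real.exp (-(δ * (geo i).dist a a')))
  /-- WRITING (3.46)₃ at U′U from block-ℓ² majorants of every `∇_k∇_lG′(U′U)` (letters at the real U). -/
  writeL2_3 : ∀ i (U U' : (bg i).Cfg) (α₁ B δ : ℝ), 0 < α₁ → α₁ ≤ aW → (bg i).Cplx337 α₁ U U' → 0 ≤ B → 0 < δ →
    (∀ k l : κ ⊕ κ, HasL2Majorant (g := toB6 (geo i) (Rr i) (Hp i)) (fun p : S i × ι => blk i p.1)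
        (conj b (diffLetter (T i) (coord i U) ((((geo i).eta : ℂ))⁻¹) k) *
          conj b (diffLetter (T i) (coord i U) ((((geo i).eta : ℂ))⁻¹) l) * Gop i ((bg i).mul U' U))
        (fun a a' => B * 1 * Real.exp (-(δ * (geo i).dist a a')))) →
    ∀ (lam : (geo i).Loc) (h : (geo i).Cut) (y y' : (geo i).Site), (geo i).cutIn h y → (geo i).suppIn lam y' →
      (Gp i).l2 3 ((bg i).mul U' U) lam h ≤
        wL B δ * B9.pref6 ((geo i).len y) 3 * (geo i).cutSup h * Real.exp (-(wLδ δ * (geo i).dist y y')) * (geo i).l2Norm lam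
  /-- READING of the mixed member (3.46)₄ at U per pair of concrete difference letters. -/
  readL2_4 : ∀ i (α₀ : ℝ) (U : (bg i).Cfg) (B₀ δ : ℝ), MInv ≤ (geo i).M → 0 < α₀ → (geo i).M * α₀ ≤ aInv →
    (bg i).Reg335 c35 α₀ U → 0 < B₀ → 0 < δ → L2Block (Gp i) B₀ δ U →
    ∀ k l : κ ⊕ κ, HasL2Majorant (g := toB6 (geo i) (Rr i) (Hp i)) (fun p : S i × ι => blk i p.1)
      (conj b (diffLetter (T i) (coord i U) ((((geo i).eta : ℂ))⁻¹) k) * Gop i U *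
        conj b (diffLetter (T i) (coord i U) ((((geo i).eta : ℂ))⁻¹) l))
      (fun a a' => cL * B₀ * 1 * Real.exp (-(δ * (geo i).dist a a')))
  /-- WRITING of the mixed member (3.46)₄ at U′U from block-ℓ² majorants of every `∇_kG′(U′U)∇♯_l`. -/
  writeL2_4 : ∀ i (U U' : (bg i).Cfg) (α₁ B δ : ℝ), 0 < α₁ → α₁ ≤ aW → (bg i).Cplx337 α₁ U U' → 0 ≤ B → 0 < δ →
    (∀ k l : κ ⊕ κ, HasL2Majorant (g := toB6 (geo i) (Rr i) (Hp i)) (fun p : S i × ι => blk i p.1)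
        (conj b (diffLetter (T i) (coord i U) ((((geo i).eta : ℂ))⁻¹) k) * Gop i ((bg i).mul U' U) *
          conj b (diffLetter (T i) (coord i U) ((((geo i).eta : ℂ))⁻¹) l))
        (fun a a' => B * 1 * Real.exp (-(δ * (geo i).dist a a')))) →
    ∀ (lam : (geo i).Loc) (h : (geo i).Cut) (y y' : (geo i).Site), (geo i).cutIn h y → (geo i).suppIn lam y' →
      (Gp i).l2 4 ((bg i).mul U' U) lam h ≤
        wL B δ * B9.pref6 ((geo i).len y) 4 * (geo i).cutSup h * Real.exp (-(wLδ δ * (geo i).dist y y')) * (geo i).l2Norm lam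
  /-- READING (3.46)₅ at U per PAIR of concrete difference letters: `G′(U)∇♯_k∇♯_l ≺₂ cL·B₀·1·e^{−δd}`. -/
  readL2_5 : ∀ i (α₀ : ℝ) (U : (bg i).Cfg) (B₀ δ : ℝ), MInv ≤ (geo i).M → 0 < α₀ → (geo i).M * α₀ ≤ aInv →
    (bg i).Reg335 c35 α₀ U → 0 < B₀ → 0 < δ → L2Block (Gp i) B₀ δ U →
    ∀ k l : κ ⊕ κ, HasL2Majorant (g := toB6 (geo i) (Rr i) (Hp i)) (fun p : S i × ι => blk i p.1)
      (Gop i U * conj b (diffLetter (T i) (coord i U) ((((geo i).eta : ℂ))⁻¹) k) *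
        conj b (diffLetter (T i) (coord i U) ((((geo i).eta : ℂ))⁻¹) l))
      (fun a a' => cL * B₀ * 1 * Real.exp (-(δ * (geo i).dist a a')))
  /-- WRITING (3.46)₅ at U′U from block-ℓ² majorants of every `G′(U′U)∇♯_k∇♯_l` (letters at the real U). -/
  writeL2_5 : ∀ i (U U' : (bg i).Cfg) (α₁ B δ : ℝ), 0 < α₁ → α₁ ≤ aW → (bg i).Cplx337 α₁ U U' → 0 ≤ B → 0 < δ →
    (∀ k l : κ ⊕ κ, HasL2Majorant (g := toB6 (geo i) (Rr i) (Hp i)) (fun p : S i × ι => blk i p.1)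
        (Gop i ((bg i).mul U' U) * conj b (diffLetter (T i) (coord i U) ((((geo i).eta : ℂ))⁻¹) k) *
          conj b (diffLetter (T i) (coord i U) ((((geo i).eta : ℂ))⁻¹) l))
        (fun a a' => B * 1 * Real.exp (-(δ * (geo i).dist a a')))) →
    ∀ (lam : (geo i).Loc) (h : (geo i).Cut) (y y' : (geo i).Site), (geo i).cutIn h y → (geo i).suppIn lam y' →
      (Gp i).l2 5 ((bg i).mul U' U) lam h ≤
        wL B δ * B9.pref6 ((geo i).len y) 5 * (geo i).cutSup h * Real.exp (-(wLδ δ * (geo i).dist y y')) * (geo i).l2Norm lam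
  /-- DISPLAYED (3.43) for G(U′U) (p. 407). -/
  stepH1G : StepH1Pos dB c35 geo bg Gp GA Cinv GA
  /-- DISPLAYED (3.44) for G(U′U) (p. 407). -/
  stepE4G : StepE4Pos dB c35 geo bg Gp GA Cinv GA
  /-- DISPLAYED (3.45) for G(U′U) (p. 407). -/
  stepH2G : StepH2Pos dB c35 geo bg Gp GA Cinv GA

variable {c35 geo bg Gp b κ S}

/-- **v6 ⇒ v5**: a `SectBFrame₆` yields a `SectBFrame₅` whose displayed (3.77) field is filled by `B9SectBL2GStepAtLettersV3.read377_of_l2GFrame₃`.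
[cite: Balaban1985BackgroundPropagators, (3.77) p.406 + Thm 3.4 p.400] -/
def SectBFrame₆.toSectBFrame₅ {GA : ∀ i, B9.KernelFamily (geo i) (bg i)} {Cinv : ∀ i, B9.SiteKernel (geo i) (bg i)}
    {IsAnalyticExt : ∀ i, B9.KernelFamily (geo i) (bg i) → (bg i).Cfg → ℝ → Prop}
    (F : SectBFrame₆ c35 geo bg Gp b κ S GA Cinv IsAnalyticExt) : SectBFrame₅ c35 geo bg Gp b κ S GA Cinv IsAnalyticExt :=
  { F with read377 := read377_of_l2GFrame₃ F.toL2GFrame₃ }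

/-- ★★ **ROW 13's `hB` IN ONE INSTANTIATION (v6)**: every `SectBFrame₆`, with the model signs of the readings and Theorems 3.2 ∕ 3.3 of the leaf, yields
`B9.SectBStepPrinted F.dB c35 geo bg Gp GA Cinv IsAnalyticExt` — `B9SectBStepFrameV5.sectBStepPrinted_of_sectBFrame₅` on `toSectBFrame₅`; ALL TWELVE `L²`
member-steps of Sect. B are theorems on the letters and NO printed inequality is displayed inside the `L²` frames (only (3.43)–(3.45) of G(U′U) remain
displayed).  Honest scope: the frame is NOT shown inhabited; nothing of Sect. B is asserted beyond what the tree's theorems prove.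
[cite: Balaban1985BackgroundPropagators, Thm 3.4 p.400 + Sect. B pp.400–407 + Thms 3.1–3.3 pp.397–399] -/
theorem sectBStepPrinted_of_sectBFrame₆ {GA : ∀ i, B9.KernelFamily (geo i) (bg i)} {Cinv : ∀ i, B9.SiteKernel (geo i) (bg i)}
    {IsAnalyticExt : ∀ i, B9.KernelFamily (geo i) (bg i) → (bg i).Cfg → ℝ → Prop}
    (F : SectBFrame₆ c35 geo bg Gp b κ S GA Cinv IsAnalyticExt)
    {P : ∀ i, (geo i).Loc → Prop} (Sg : ∀ i, B9FromB6ModelSignsOn.ModelSignsOn (geo i) (P i))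
    (h32 : B9.Thm32Printed F.dB c35 geo bg Cinv) (h33 : B9.Thm33Printed c35 geo bg Gp GA) :
    B9.SectBStepPrinted F.dB c35 geo bg Gp GA Cinv IsAnalyticExt :=
  sectBStepPrinted_of_sectBFrame₅ F.toSectBFrame₅ Sg h32 h33

end Literature.MathematicalPhysics.QuantumFieldTheory.Balaban1983to89.B9SectBStepFrameV6
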